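import Summits.CriticalPhenomena.CardyFormulaZ2.Theorems.CardyIKTransportIKLinearTransportScreeningArray4

/-!
# Screening estimates for a finite array of independent biased bits, part 5: the EXACT screening sum

Support file (`--supports stmt-CriticalPhenomena-5076`, registered sub-goal `screeningArrayExact`) for the line
`pinned-diagram-exchange` (crux `IKLinearTransport`): preparation of the `RatioMixBound` hypothesis family of the
transport crux (ratio mixing for boxes of ALL aspect ratios). Continues parts 1, 3, 4 (`…ScreeningArray{,3,4}`).
* `sigmaExact m k n θ`: the closed form of `Σ_{(C,R) ∉ {(∅,∅),(all,all)}} θ^{#(X(C,R) ∖ UR)}`.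
* `sum_cols_pow_nOut`: COLUMN FACTORISATION — for a fixed row set `R` the sum over the column sets `C` is a
  product over columns (`Fintype.prod_sum`): a low column `c < n` contributes `θ^{#{R = false}} + θ^{#{R = true}}`,
  a high column `c ≥ n` contributes `θ^{#{r < n : R r = false}} + θ^{#{r < n : R r = true}}`.
* `sum_boolFun_card`, `sum_boolFun_two_blocks`: counting the row sets by `(#(R ∩ {r < n}), #(R ∖ {r < n}))`
  (`Equiv.piEquivPiSubtypeProd`, `Finset.sum_powerset_apply_card`) gives the multiplicities `C(n,b₁) C(k-n,r₂)`.
* `sum_nontrivial_eq`: `Σ_{(C,R) nontrivial} θ^{#(X(C,R) ∖ UR)} = sigmaExact m k n θ` EXACTLY.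
* `abs_arrSum_chiY_mul_le_rel`: the RELATIVE factorisation bound `|E[χ_X F]| ≤ θ^{#(X ∖ UR)} E[F]` for `F ≥ 0`
  reading only the upper-right region.
* `screeningArrayExact`: `|E[F; kk] - E[F] P(kk)| ≤ 2 Σ_exact E[F] P(kk)` (product form).
Sequel: part 6 (`sigmaExact_small`: `Σ_exact → 0` uniformly over aspect ratios `≤ K`).
-/

noncomputable section

namespace Summit.CriticalPhenomena.CardyFormulaZ2.Theorems.IKLinearTransport.PinnedDiagramExchange.ScreeningArray

open Finset

variable {m k : ℕ}

/-- The EXACT screening sum `Σ_{(C,R) nontrivial} θ^{#(X(C,R) ∖ UR)}` in closed form: for fixed `R` with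
`b₁ = #(R ∩ {r < n})`, `ρ = #R`, the sum over `C` factorises over columns — a column `c < n` contributes
`θ^{k-ρ} + θ^{ρ}`, a column `c ≥ n` contributes `θ^{n-b₁} + θ^{b₁}` —, and the two trivial pairs contribute
`1` each. [folklore] -/
def sigmaExact (m k n : ℕ) (θ : ℝ) : ℝ :=
  (∑ b₁ ∈ Finset.range (n + 1), ∑ r₂ ∈ Finset.range (k - n + 1),
      (n.choose b₁ : ℝ) * ((k - n).choose r₂ : ℝ) *
        (θ ^ (k - b₁ - r₂) + θ ^ (b₁ + r₂)) ^ n * (θ ^ (n - b₁) + θ ^ b₁) ^ (m - n)) - 2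

/-! ## Column factorisation of the screening sum -/

/-- Column decomposition of the count of unread exchange entries:
`#(X(C,R) ∖ UR) = Σ_c #{r : [C c] ≠ [R r], (c, r) ∉ UR}`. -/
theorem nOut_eq_sum_cols (n : ℕ) (C : Fin m → Bool) (R : Fin k → Bool) :
    nOut n C R = ∑ c : Fin m,
      (univ.filter fun r : Fin k => (xor (C c) (R r) = true) ∧ ¬(n ≤ (c : ℕ) ∧ n ≤ (r : ℕ))).card := by
  unfold nOut xSet
  rw [Finset.filter_filter, Finset.card_filter, Fintype.sum_prod_type]
  exact Finset.sum_congr rfl fun c _ => (Finset.card_filter _ _).symm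

/-- A low column `c < n`: every row counts, `#{r : [b] ≠ [R r]} = #{r : R r = ¬b}`. -/
theorem colCount_low (n : ℕ) (c : Fin m) (hc : (c : ℕ) < n) (R : Fin k → Bool) (b : Bool) :
    (univ.filter fun r : Fin k => (xor b (R r) = true) ∧ ¬(n ≤ (c : ℕ) ∧ n ≤ (r : ℕ))).card =
      (univ.filter fun r : Fin k => R r = !b).card := by
  congr 1
  refine Finset.filter_congr fun r _ => ?_
  have h : ¬(n ≤ (c : ℕ) ∧ n ≤ (r : ℕ)) := fun h => absurd h.1 (by omega)
  cases b <;> cases R r <;> simp [h]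

/-- A high column `c ≥ n`: only the low rows count, `#{r < n : [b] ≠ [R r]} = #{r < n : R r = ¬b}`. -/
theorem colCount_high (n : ℕ) (c : Fin m) (hc : ¬(c : ℕ) < n) (R : Fin k → Bool) (b : Bool) :
    (univ.filter fun r : Fin k => (xor b (R r) = true) ∧ ¬(n ≤ (c : ℕ) ∧ n ≤ (r : ℕ))).card =
      (univ.filter fun r : Fin k => (r : ℕ) < n ∧ R r = !b).card := by
  congr 1
  refine Finset.filter_congr fun r _ => ?_
  have h : ¬(n ≤ (c : ℕ) ∧ n ≤ (r : ℕ)) ↔ (r : ℕ) < n := ⟨fun h => by omega, fun h h' => by omega⟩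
  rw [h]
  cases b <;> cases R r <;> simp

/-- COLUMN FACTORISATION: for a fixed row set `R`, `Σ_C θ^{#(X(C,R) ∖ UR)}` is a product over the columns,
`(θ^{#{R = false}} + θ^{#{R = true}})^n (θ^{#{r < n, R r = false}} + θ^{#{r < n, R r = true}})^{m-n}`. -/
theorem sum_cols_pow_nOut (n : ℕ) (hnm : n ≤ m) (θ : ℝ) (R : Fin k → Bool) :
    ∑ C : Fin m → Bool, θ ^ nOut n C R =
      (θ ^ (univ.filter fun r : Fin k => R r = false).card +
          θ ^ (univ.filter fun r : Fin k => R r = true).card) ^ n *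
        (θ ^ (univ.filter fun r : Fin k => (r : ℕ) < n ∧ R r = false).card +
          θ ^ (univ.filter fun r : Fin k => (r : ℕ) < n ∧ R r = true).card) ^ (m - n) := by
  set g : Fin m → Bool → ℕ := fun c b =>
    (univ.filter fun r : Fin k => (xor b (R r) = true) ∧ ¬(n ≤ (c : ℕ) ∧ n ≤ (r : ℕ))).card with hg
  have h1 : ∀ C : Fin m → Bool, θ ^ nOut n C R = ∏ c, θ ^ g c (C c) := fun C => by
    rw [nOut_eq_sum_cols, Finset.prod_pow_eq_pow_sum]
  simp only [h1]
  rw [← Fintype.prod_sum fun c b => θ ^ g c b]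
  have h2 : ∀ c : Fin m, ∑ b : Bool, θ ^ g c b =
      if (c : ℕ) < n then
        θ ^ (univ.filter fun r : Fin k => R r = false).card +
          θ ^ (univ.filter fun r : Fin k => R r = true).card
      else
        θ ^ (univ.filter fun r : Fin k => (r : ℕ) < n ∧ R r = false).card +
          θ ^ (univ.filter fun r : Fin k => (r : ℕ) < n ∧ R r = true).card := by
    intro c
    rw [Fintype.sum_bool]
    by_cases hc : (c : ℕ) < n
    · rw [if_pos hc]
      simp only [hg]
      rw [colCount_low n c hc R true, colCount_low n c hc R false]
      rfl
    · rw [if_neg hc]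
      simp only [hg]
      rw [colCount_high n c hc R true, colCount_high n c hc R false]
      rfl
  rw [Finset.prod_congr rfl fun c _ => h2 c, Finset.prod_ite, Finset.prod_const, Finset.prod_const,
    Fin.card_filter_val_lt, min_eq_right hnm]
  congr 2
  have h := Finset.card_filter_add_card_filter_not (s := (univ : Finset (Fin m)))
    (fun c : Fin m => (c : ℕ) < n)
  rw [Fin.card_filter_val_lt, min_eq_right hnm, Finset.card_univ, Fintype.card_fin] at h
  omega

/-- Counting the `Bool`-valued functions on a finite type by their number of `true`s:
`Σ_S ψ(#{S = true}) = Σ_b C(#ι, b) ψ(b)`. -/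
theorem sum_boolFun_card {ι : Type*} [Fintype ι] [DecidableEq ι] (ψ : ℕ → ℝ) :
    ∑ S : ι → Bool, ψ (univ.filter fun i => S i = true).card =
      ∑ b ∈ range (Fintype.card ι + 1), ((Fintype.card ι).choose b : ℝ) * ψ b := by
  have h := Finset.sum_powerset_apply_card ψ (x := (univ : Finset ι))
  rw [Finset.powerset_univ, Finset.card_univ] at h
  simp only [nsmul_eq_mul] at h
  rw [← h]
  refine Fintype.sum_bijective (fun S : ι → Bool => univ.filter fun i => S i = true)
    ⟨fun S S' hSS' => ?_, fun t => ⟨fun i => decide (i ∈ t), ?_⟩⟩ _ _ fun S => rfl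
  · funext i
    have hi := Finset.ext_iff.mp hSS' i
    simp only [Finset.mem_filter, Finset.mem_univ, true_and] at hi
    exact Bool.eq_iff_iff.mpr hi
  · ext i
    simp

/-- Restricting a count to a subtype: `#{r : p r ∧ Q r} = #{i : {r // p r} | Q i}`. -/
theorem card_filter_and_eq_card_subtype {α : Type*} [Fintype α] (p : α → Prop) [DecidablePred p]
    (Q : α → Prop) [DecidablePred Q] :
    (univ.filter fun r => p r ∧ Q r).card = (univ.filter fun i : {r // p r} => Q i.1).card := by
  have h : (univ.filter fun i : {r // p r} => Q i.1) = (univ.filter Q).subtype p := by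
    ext i
    simp
  rw [h, Finset.card_subtype, Finset.filter_filter]
  congr 1
  exact Finset.filter_congr fun r _ => by tauto

/-- TWO-BLOCK COUNTING: summing a function of `(#{r < n : R r}, #{r ≥ n : R r})` over all row sets
`R : Fin k → Bool` produces the binomial multiplicities `C(n, b₁) C(k - n, r₂)`. -/
theorem sum_boolFun_two_blocks (n k : ℕ) (hnk : n ≤ k) (φ : ℕ → ℕ → ℝ) :
    ∑ R : Fin k → Bool, φ (univ.filter fun r : Fin k => (r : ℕ) < n ∧ R r = true).card
        (univ.filter fun r : Fin k => ¬((r : ℕ) < n) ∧ R r = true).card =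
      ∑ b₁ ∈ range (n + 1), ∑ r₂ ∈ range (k - n + 1),
        (n.choose b₁ : ℝ) * ((k - n).choose r₂ : ℝ) * φ b₁ r₂ := by
  set e := Equiv.piEquivPiSubtypeProd (fun r : Fin k => (r : ℕ) < n) (fun _ => Bool) with he
  rw [← e.symm.sum_comp, Fintype.sum_prod_type]
  have h1 : ∀ (S₁ : {r : Fin k // (r : ℕ) < n} → Bool) (S₂ : {r : Fin k // ¬((r : ℕ) < n)} → Bool),
      (univ.filter fun r : Fin k => (r : ℕ) < n ∧ e.symm (S₁, S₂) r = true).card =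
        (univ.filter fun i : {r : Fin k // (r : ℕ) < n} => S₁ i = true).card := by
    intro S₁ S₂
    rw [card_filter_and_eq_card_subtype]
    congr 1
    refine Finset.filter_congr fun i _ => ?_
    simp [he, i.2]
  have h2 : ∀ (S₁ : {r : Fin k // (r : ℕ) < n} → Bool) (S₂ : {r : Fin k // ¬((r : ℕ) < n)} → Bool),
      (univ.filter fun r : Fin k => ¬((r : ℕ) < n) ∧ e.symm (S₁, S₂) r = true).card =
        (univ.filter fun i : {r : Fin k // ¬((r : ℕ) < n)} => S₂ i = true).card := by
    intro S₁ S₂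
    rw [card_filter_and_eq_card_subtype]
    congr 1
    refine Finset.filter_congr fun i _ => ?_
    simp [he, i.2]
  simp only [h1, h2]
  have hc1 : Fintype.card {r : Fin k // (r : ℕ) < n} = n := Fintype.card_fin_lt_of_le hnk
  have hc2 : Fintype.card {r : Fin k // ¬((r : ℕ) < n)} = k - n := by
    rw [Fintype.card_subtype_compl, Fintype.card_fin, hc1]
  simp only [sum_boolFun_card, hc2]
  rw [sum_boolFun_card (ψ := fun b₁ => ∑ b ∈ range (k - n + 1), ((k - n).choose b : ℝ) * φ b₁ b), hc1]
  refine Finset.sum_congr rfl fun b₁ _ => ?_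
  rw [Finset.mul_sum]
  exact Finset.sum_congr rfl fun r₂ _ => by ring

/-- The row counts of a row set `R` in terms of `b₁ = #{r < n : R r}` and `r₂ = #{r ≥ n : R r}`. -/
theorem row_counts (n : ℕ) (hnk : n ≤ k) (R : Fin k → Bool) :
    (univ.filter fun r : Fin k => R r = true).card =
        (univ.filter fun r : Fin k => (r : ℕ) < n ∧ R r = true).card +
          (univ.filter fun r : Fin k => ¬((r : ℕ) < n) ∧ R r = true).card ∧
      (univ.filter fun r : Fin k => R r = false).card +
          (univ.filter fun r : Fin k => R r = true).card = k ∧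
      (univ.filter fun r : Fin k => (r : ℕ) < n ∧ R r = false).card +
          (univ.filter fun r : Fin k => (r : ℕ) < n ∧ R r = true).card = n := by
  refine ⟨?_, ?_, ?_⟩
  · have h := Finset.card_filter_add_card_filter_not (s := univ.filter fun r : Fin k => R r = true)
      (fun r : Fin k => (r : ℕ) < n)
    rw [Finset.filter_filter, Finset.filter_filter] at h
    rw [← h]
    congr 2
    · exact Finset.filter_congr fun r _ => by tauto
    · exact Finset.filter_congr fun r _ => by tauto
  · have h := Finset.card_filter_add_card_filter_not (s := (univ : Finset (Fin k)))
      (fun r : Fin k => R r = false)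
    rw [Finset.card_univ, Fintype.card_fin] at h
    simpa using h
  · have h := Finset.card_filter_add_card_filter_not (s := univ.filter fun r : Fin k => (r : ℕ) < n)
      (fun r : Fin k => R r = false)
    rw [Finset.filter_filter, Finset.filter_filter, Fin.card_filter_val_lt, min_eq_right hnk] at h
    simpa using h

/-- THE EXACT SCREENING SUM over all pairs: `Σ_{(C,R)} θ^{#(X(C,R) ∖ UR)} = sigmaExact m k n θ + 2`. -/
theorem sum_all_pow_nOut (m k n : ℕ) (hnm : n ≤ m) (hnk : n ≤ k) (θ : ℝ) :
    ∑ x : (Fin m → Bool) × (Fin k → Bool), θ ^ nOut n x.1 x.2 = sigmaExact m k n θ + 2 := by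
  unfold sigmaExact
  rw [sub_add_cancel, Fintype.sum_prod_type_right]
  dsimp only
  have key := sum_boolFun_two_blocks n k hnk (fun b₁ r₂ =>
    (θ ^ (k - b₁ - r₂) + θ ^ (b₁ + r₂)) ^ n * (θ ^ (n - b₁) + θ ^ b₁) ^ (m - n))
  simp only [mul_assoc] at key ⊢
  rw [← key]
  refine Finset.sum_congr rfl fun R _ => ?_
  rw [sum_cols_pow_nOut n hnm θ R]
  obtain ⟨h1, h2, h3⟩ := row_counts n hnk R
  set b₁ := (univ.filter fun r : Fin k => (r : ℕ) < n ∧ R r = true).card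
  set r₂ := (univ.filter fun r : Fin k => ¬((r : ℕ) < n) ∧ R r = true).card
  have e1 : (univ.filter fun r : Fin k => R r = false).card = k - b₁ - r₂ := by omega
  have e2 : (univ.filter fun r : Fin k => (r : ℕ) < n ∧ R r = false).card = n - b₁ := by omega
  rw [e1, e2, h1]

/-- THE EXACT SCREENING SUM: `Σ_{(C,R) ∉ {(∅,∅),(all,all)}} θ^{#(X(C,R) ∖ UR)} = sigmaExact m k n θ`
(the two trivial pairs have `X = ∅`). -/
theorem sum_nontrivial_eq (m k n : ℕ) (hn : 1 ≤ n) (hnm : n ≤ m) (hnk : n ≤ k) (θ : ℝ) :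
    ∑ x ∈ ((univ : Finset ((Fin m → Bool) × (Fin k → Bool))).erase (fun _ => false, fun _ => false)).erase
        (fun _ => true, fun _ => true), θ ^ nOut n x.1 x.2 = sigmaExact m k n θ := by
  set bot : (Fin m → Bool) × (Fin k → Bool) := (fun _ => false, fun _ => false) with hbot
  set top : (Fin m → Bool) × (Fin k → Bool) := (fun _ => true, fun _ => true) with htop
  have htb : top ≠ bot := fun h => by
    have := congrFun (congrArg Prod.fst h) ⟨0, by omega⟩
    simp [htop, hbot] at this
  have hxb : nOut n bot.1 bot.2 = 0 := by simp [nOut, xSet, hbot]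
  have hxt : nOut n top.1 top.2 = 0 := by simp [nOut, xSet, htop]
  rw [Finset.sum_erase_eq_sub (Finset.mem_erase.mpr ⟨htb, Finset.mem_univ top⟩),
    Finset.sum_erase_eq_sub (Finset.mem_univ bot), sum_all_pow_nOut m k n hnm hnk θ, hxb, hxt]
  ring

/-- `sigmaExact` is a sum of powers of `θ ≥ 0`, hence nonnegative. -/
theorem sigmaExact_nonneg (m k n : ℕ) (hn : 1 ≤ n) (hnm : n ≤ m) (hnk : n ≤ k) (θ : ℝ) (hθ0 : 0 ≤ θ) :
    0 ≤ sigmaExact m k n θ := by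
  rw [← sum_nontrivial_eq m k n hn hnm hnk θ]
  exact Finset.sum_nonneg fun x _ => pow_nonneg hθ0 _

/-- RELATIVE FACTORISATION BOUND: a nonnegative `F` reading only the upper-right region satisfies
`|E[χ_X F]| ≤ θ^{#(X ∖ UR)} · E[F]`. -/
theorem abs_arrSum_chiY_mul_le_rel (p : Fin m → ℝ) (hp : ∀ c, 0 ≤ p c ∧ p c ≤ 1) (θ : ℝ) (hθ0 : 0 ≤ θ)
    (hθ1 : θ ≤ 1) (hpθ : ∀ c, |1 - 2 * p c| ≤ θ) (n : ℕ) (F : (Fin m × Fin k → Bool) → ℝ)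
    (hF0 : ∀ q, 0 ≤ F q)
    (hF : ∀ q q' : Fin m × Fin k → Bool,
      (∀ f : Fin m × Fin k, n ≤ (f.1 : ℕ) → n ≤ (f.2 : ℕ) → q f = q' f) → F q = F q')
    (X : Finset (Fin m × Fin k)) :
    |arrSum p (fun q => chiY X q * F q)| ≤
      θ ^ (X.filter fun f => ¬(n ≤ (f.1 : ℕ) ∧ n ≤ (f.2 : ℕ))).card * arrSum p F := by
  set Y := X.filter fun f => ¬(n ≤ (f.1 : ℕ) ∧ n ≤ (f.2 : ℕ)) with hY
  set Z := X.filter fun f => (n ≤ (f.1 : ℕ) ∧ n ≤ (f.2 : ℕ)) with hZ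
  have hsplit : ∀ q, chiY X q = chiY Y q * chiY Z q := fun q => by
    unfold chiY
    rw [← Finset.prod_filter_mul_prod_filter_not X (fun f => n ≤ (f.1 : ℕ) ∧ n ≤ (f.2 : ℕ))]
    ring
  have hK : ∀ f ∈ Y, ∀ q b,
      chiY Z (Function.update q f b) * F (Function.update q f b) = chiY Z q * F q := by
    intro f hf q b
    have hfY := (Finset.mem_filter.mp hf).2
    have hfZ : f ∉ Z := fun h => hfY (Finset.mem_filter.mp h).2
    congr 1
    · exact Finset.prod_congr rfl fun f' hf' => by
        rw [Function.update_of_ne (ne_of_mem_of_not_mem hf' hfZ)]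
    · refine hF _ _ fun f' h1 h2 => ?_
      have hne : f' ≠ f := by
        rintro rfl
        exact hfY ⟨h1, h2⟩
      rw [Function.update_of_ne hne]
  have h1 : |arrSum p (fun q => chiY Z q * F q)| ≤ arrSum p F := by
    unfold arrSum
    calc |∑ q, arrWeight p q * (chiY Z q * F q)| ≤ ∑ q, |arrWeight p q * (chiY Z q * F q)| :=
          Finset.abs_sum_le_sum_abs _ _
      _ = ∑ q, arrWeight p q * F q := Finset.sum_congr rfl fun q _ => by
          rw [abs_mul, abs_mul, abs_chiY, one_mul, abs_of_nonneg (arrWeight_nonneg p hp q),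
            abs_of_nonneg (hF0 q)]
      _ ≤ _ := le_rfl
  calc |arrSum p (fun q => chiY X q * F q)| = |arrSum p (fun q => chiY Y q * (chiY Z q * F q))| := by
        simp_rw [hsplit, mul_assoc]
    _ = |∏ f ∈ Y, (1 - 2 * p f.1)| * |arrSum p (fun q => chiY Z q * F q)| := by
        rw [arrSum_chiY_mul p Y _ hK, abs_mul]
    _ ≤ θ ^ Y.card * arrSum p F :=
        mul_le_mul (abs_prod_bias_le p θ hθ0 hθ1 hpθ Y Y.card le_rfl) h1 (abs_nonneg _) (pow_nonneg hθ0 _)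

/-- REGISTERED SUB-GOAL `screeningArrayExact` — the screening estimate with the EXACT sum and in PRODUCT
(double-ratio) form: `|E[F; par = kk] − E[F] P(par = kk)| ≤ 2 Σ_exact · E[F] · P(par = kk)`.
Same Fourier proof as `screeningArray` (landed helpers `indicator_expand`, `arrSum_chiY_mul`): the error terms
are `|E[F χ_X]| ≤ E[F] · θ^{#(X∖UR)}` (F ≥ 0), summed exactly by the column factorisation. [folklore] -/
theorem screeningArrayExact :
    ∀ (m k n : ℕ), 1 ≤ n → n ≤ m → n ≤ k → ∀ (p : Fin m → ℝ) (θ : ℝ),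
      (∀ c, 0 ≤ p c ∧ p c ≤ 1) → 0 ≤ θ → θ ≤ 1 → (∀ c, |1 - 2 * p c| ≤ θ) → sigmaExact m k n θ ≤ 1 →
      ∀ (F : (Fin m × Fin k → Bool) → ℝ), (∀ q, 0 ≤ F q ∧ F q ≤ 1) →
      (∀ q q' : Fin m × Fin k → Bool,
        (∀ f : Fin m × Fin k, n ≤ (f.1 : ℕ) → n ≤ (f.2 : ℕ) → q f = q' f) → F q = F q') →
      ∀ (kk : (Fin m → Bool) × (Fin k → Bool)),
      |arrSum p (fun q => if parities q = kk then F q else 0) -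
          arrSum p F * arrSum p (fun q => if parities q = kk then 1 else 0)| ≤
        2 * sigmaExact m k n θ * (arrSum p F * arrSum p (fun q => if parities q = kk then 1 else 0)) := by
  intro m k n hn hnm hnk p θ hp hθ0 hθ1 hpθ hσ1 F hF01 hF kk
  set σ := sigmaExact m k n θ with hσ
  have hσ0 : 0 ≤ σ := sigmaExact_nonneg m k n hn hnm hnk θ hθ0
  -- the inconsistent case: no array has parities `kk`
  by_cases hcons : ∃ q₀ : Fin m × Fin k → Bool, parities q₀ = kk
  swap
  · have h0 : ∀ H : (Fin m × Fin k → Bool) → ℝ, arrSum p (fun q => if parities q = kk then H q else 0) = 0 := by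
      intro H
      unfold arrSum
      refine Finset.sum_eq_zero fun q _ => ?_
      dsimp only
      rw [if_neg (fun h => hcons ⟨q, h⟩), mul_zero]
    rw [h0 F, h0 (fun _ => 1)]
    simp
  obtain ⟨q₀, hq₀⟩ := hcons
  -- the pairs `(C, R)` and the two trivial ones
  set bot : (Fin m → Bool) × (Fin k → Bool) := (fun _ => false, fun _ => false) with hbot
  set top : (Fin m → Bool) × (Fin k → Bool) := (fun _ => true, fun _ => true) with htop
  set s := ((univ : Finset ((Fin m → Bool) × (Fin k → Bool))).erase bot).erase top with hs
  have htb : top ≠ bot := fun h => by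
    have := congrFun (congrArg Prod.fst h) ⟨0, by omega⟩
    simp [htop, hbot] at this
  have hsum : ∑ x ∈ s, θ ^ nOut n x.1 x.2 = σ := sum_nontrivial_eq m k n hn hnm hnk θ
  -- expansion of `E[H; kk]` with the two trivial terms separated
  have hexp : ∀ H : (Fin m × Fin k → Bool) → ℝ,
      arrSum p (fun q => if parities q = kk then H q else 0) =
        (2 * arrSum p H + ∑ x ∈ s, epsCR kk x.1 x.2 * arrSum p (fun q => chiY (xSet x.1 x.2) q * H q)) /
          2 ^ (m + k) := by
    intro H
    rw [arrSum_indicator_expand]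
    congr 1
    rw [show (∑ C : Fin m → Bool, ∑ R : Fin k → Bool,
        epsCR kk C R * arrSum p (fun q => chiY (xSet C R) q * H q)) =
        ∑ x : (Fin m → Bool) × (Fin k → Bool),
          epsCR kk x.1 x.2 * arrSum p (fun q => chiY (xSet x.1 x.2) q * H q) from
      (Fintype.sum_prod_type' fun (C : Fin m → Bool) (R : Fin k → Bool) =>
        epsCR kk C R * arrSum p (fun q => chiY (xSet C R) q * H q)).symm]
    rw [← Finset.add_sum_erase _ _ (Finset.mem_univ bot),
      ← Finset.add_sum_erase _ _ (Finset.mem_erase.mpr ⟨htb, Finset.mem_univ top⟩)]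
    have hxb : xSet bot.1 bot.2 = ∅ := by ext f; simp [hbot, xSet]
    have hxt : xSet top.1 top.2 = ∅ := by ext f; simp [htop, xSet]
    have heb : epsCR kk bot.1 bot.2 = 1 := by simp [hbot, epsCR]
    have het : epsCR kk top.1 top.2 = 1 := epsCR_top_eq_one q₀ kk hq₀
    simp only [hxb, hxt, heb, het, chiY_empty, one_mul]
    ring
  -- the nontrivial terms are bounded by `Σ_exact · E[H]`
  have hbound : ∀ H : (Fin m × Fin k → Bool) → ℝ, (∀ q, 0 ≤ H q ∧ H q ≤ 1) →
      (∀ q q' : Fin m × Fin k → Bool,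
        (∀ f : Fin m × Fin k, n ≤ (f.1 : ℕ) → n ≤ (f.2 : ℕ) → q f = q' f) → H q = H q') →
      |∑ x ∈ s, epsCR kk x.1 x.2 * arrSum p (fun q => chiY (xSet x.1 x.2) q * H q)| ≤ σ * arrSum p H := by
    intro H hH01 hH
    calc |∑ x ∈ s, epsCR kk x.1 x.2 * arrSum p (fun q => chiY (xSet x.1 x.2) q * H q)|
        ≤ ∑ x ∈ s, |epsCR kk x.1 x.2 * arrSum p (fun q => chiY (xSet x.1 x.2) q * H q)| :=
          Finset.abs_sum_le_sum_abs _ _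
      _ ≤ ∑ x ∈ s, θ ^ nOut n x.1 x.2 * arrSum p H := Finset.sum_le_sum fun x _ => by
          rw [abs_mul, abs_epsCR, one_mul]
          exact abs_arrSum_chiY_mul_le_rel p hp θ hθ0 hθ1 hpθ n H (fun q => (hH01 q).1) hH _
      _ = σ * arrSum p H := by rw [← Finset.sum_mul, hsum]
  set e1 := ∑ x ∈ s, epsCR kk x.1 x.2 * arrSum p (fun q => chiY (xSet x.1 x.2) q * F q) with he1
  set e2 := ∑ x ∈ s, epsCR kk x.1 x.2 * arrSum p (fun q => chiY (xSet x.1 x.2) q * (fun _ => (1 : ℝ)) q)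
    with he2
  have h1one : arrSum p (fun _ : Fin m × Fin k → Bool => (1 : ℝ)) = 1 := by
    unfold arrSum
    simp only [mul_one]
    exact sum_arrWeight p
  have hb1 := hbound F hF01 hF
  have hb2 := hbound (fun _ => (1 : ℝ)) (fun _ => by norm_num) (fun _ _ _ => rfl)
  rw [← he1] at hb1
  rw [← he2, h1one, mul_one] at hb2
  have hEF : arrSum p (fun q => if parities q = kk then F q else 0) = (2 * arrSum p F + e1) / 2 ^ (m + k) :=
    hexp F
  have hW : arrSum p (fun q => if parities q = kk then (1 : ℝ) else 0) = (2 + e2) / 2 ^ (m + k) := by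
    have h := hexp (fun _ => (1 : ℝ))
    rw [h1one, mul_one] at h
    exact h
  have hEF0 : 0 ≤ arrSum p F := Finset.sum_nonneg fun q _ => mul_nonneg (arrWeight_nonneg p hp q) (hF01 q).1
  have hD : (0 : ℝ) < 2 ^ (m + k) := by positivity
  rw [hEF, hW]
  rw [abs_le] at hb1 hb2
  have hlhs : (2 * arrSum p F + e1) / 2 ^ (m + k) - arrSum p F * ((2 + e2) / 2 ^ (m + k)) =
      (e1 - arrSum p F * e2) / 2 ^ (m + k) := by
    field_simp
    ring
  rw [hlhs, abs_div, abs_of_pos hD, div_le_iff₀ hD,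
    show 2 * σ * (arrSum p F * ((2 + e2) / 2 ^ (m + k))) * 2 ^ (m + k) = 2 * σ * (arrSum p F * (2 + e2)) by
      field_simp]
  have hσE : 0 ≤ σ * arrSum p F := mul_nonneg hσ0 hEF0
  calc |e1 - arrSum p F * e2| ≤ |e1| + |arrSum p F * e2| := abs_sub _ _
    _ ≤ σ * arrSum p F + arrSum p F * σ := by
        rw [abs_mul, abs_of_nonneg hEF0]
        have h1 : |e1| ≤ σ * arrSum p F := abs_le.mpr hb1
        have h2 : |e2| ≤ σ := abs_le.mpr hb2
        nlinarith [abs_nonneg e2]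
    _ ≤ 2 * σ * (arrSum p F * (2 + e2)) := by
        nlinarith [mul_nonneg hσE (show (0 : ℝ) ≤ 1 + e2 by linarith)]

end Summit.CriticalPhenomena.CardyFormulaZ2.Theorems.IKLinearTransport.PinnedDiagramExchange.ScreeningArray
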